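import Literature.NumberTheory.Automorphic.BrandtMatrixDegreeSquarefree
import Literature.NumberTheory.Automorphic.BrandtMatrixRamifiedPowers
import Literature.NumberTheory.Automorphic.QuaternionLocalSplitIdealCount
import Literature.NumberTheory.Automorphic.EichlerOrderLocallyMaximal
import HarnessLib

/-!
# The degree of the Brandt matrices at every argument prime to the level:
# `Σ_i T(n)_ij = Σ_{d ∣ n, (d, N⁻) = 1} d` (Eichler's count of the integral ideals of reduced norm `n`)

Topic `NumberTheory/Automorphic`; theorems only (no definition, no named fact, no instance).
Sequel of `BrandtMatrixDegreeSquarefree.lean` (squarefree `n`), removing the squarefree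
hypothesis. For a Brandt setup `S = (D, O)` of type `(N⁺, N⁻)` (`Brandt.XiSetup`) the `j`-th
column sum of `T(n) = Brandt.matrix S.O n` is the number of integral right ideals `M ⊆ I_j` with
`[I_j : M] = n²` (`XiSetup.sum_matrix_eq_ncard_subideals`). Eichler (LNM 320, Ch. II §2 and §6,
Thm. 2 with Cor. 1: the one-rowed component `b(n)` of the Brandt matrices «is equal to the number of
integral left (or right) ideals of norm `n`», the coefficient of the zeta function
`ζ(s) = ∏_{p ∤ DH} (1 − p^{−2s})⁻¹(1 − p^{1−2s})⁻¹ ∏_{p ∣ D} (1 − p^{−2s})⁻¹ …`) computed it prime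
by prime; here:

* §1 **`XiSetup.ncard_subideals_prime_pow_eq`, `XiSetup.sum_matrix_prime_pow_eq`** — at a good
  prime `p ∤ N⁺N⁻`: `#{M ⊆ I_j : [I_j : M] = p^{2k}} = Σ_i T(p^k)_ij = σ₁(p^k) = 1 + p + ⋯ + p^k`
  (Kaplansky–local principality `card_subideals_eq_card_localPrincipal` and the Hermite normal
  forms of `M₂(ℤ_p)`, `card_principal_ideals_of_split`, through the matrix model of the Eichler
  order at `p`);
* §2 **`XiSetup.ncard_subideals_ramified_pow_eq_one`, `XiSetup.sum_matrix_ramified_pow_eq_one`** —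
  at a ramified prime `p ∣ N⁻`: exactly one integral ideal of index `p^{2a}` below each `I_j`
  (`exists_subideal_pow`, `subideal_pow_unique` of `BrandtMatrixRamifiedPowers.lean`: `I_j 𝔓^a`);
* §3 **`XiSetup.sum_matrix_eq_sigma`** (`Σ_i T(n)_ij = σ₁(n)` for every `n ≥ 1` prime to `N⁺N⁻`),
  **`XiSetup.sum_matrix_eq_one_of_supported`** (`= 1` for `n` supported on the primes of `N⁻`),
  **`XiSetup.sum_matrix_mul_eq_sigma`** (`Σ_i T(n₁n₂)_ij = σ₁(n₁)`: Eichler's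
  `b(n) = Σ_{d ∣ n, (d, N⁻) = 1} d` for every `n = n₁n₂` prime to `N⁺`), and the counts of
  integral ideals `XiSetup.ncard_subideals_eq_sigma`, `XiSetup.ncard_subideals_mul_eq_sigma`
  (multiplicativity of the column sums, `XiSetup.sum_matrix_mul_of_coprime`);
* §4 class number one: `XiSetup.matrix_apply_eq_sigma_of_subsingleton` (`T(n) = σ₁(n)`),
  `XiSetup.matrix_apply_mul_eq_sigma_of_subsingleton`, and the representation numbers of the norm
  form of a definite order of class number one at EVERY argument prime to `N⁺`:
  **`XiSetup.natCard_reducedNorm_eq_of_subsingleton`** (`#{x ∈ O_L(I_i) : nrd x = n₁n₂} = 2 w_i σ₁(n₁)`)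
  — e.g. for the maximal orders of discriminant `D ∈ {2, 3, 5, 7, 13}` (`N⁺ = 1`, `w = 12/(D−1)`):
  `r_D(n) = (24/(D−1)) (σ₁(n) − D σ₁(n/D))` for all `n ≥ 1` (Jacobi / Williams Thm. 17.3 / Voight
  Exercise 17.10 at all arguments).

## References

* M. Eichler, *The basis problem for modular forms and the traces of the Hecke operators*, in:
  Modular Functions of One Variable I, LNM 320 (1973), Ch. II §2 (the local factors `ζ_p(s)`),
  §6 (16), Thm. 2 (18)–(20) and Cor. 1 [Eichler1973].
* M.-F. Vignéras, *Arithmétique des algèbres de quaternions*, LNM 800 (1980), Ch. II §1 Lemme 1.5,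
  §2 Thm. 2.3; Ch. III §5 exercice 5.8 (a)–(c) [VignerasLNM800].
* B. H. Gross, *Heights and the special values of L-series* (1987), §1 (`deg t_m = σ₁(m)`) [Gross1987].
-/

noncomputable section

open scoped Pointwise
open Finset
open ArithmeticFunction
open Literature.NumberTheory.Automorphic.Brandt

namespace Literature.NumberTheory.Automorphic

namespace Brandt

variable {Nplus Nminus : ℕ}

/-! ## §1 Good prime powers -/

section Good

/-- **`#{M ⊆ I_j : [I_j : M] = p^{2k}} = 1 + p + ⋯ + p^k` at a prime `p ∤ N⁺N⁻`** for every class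
representative `I_j` of a Brandt setup: the count only depends on `O_(p) ≅ M₂(ℤ_p)` (Kaplansky),
where the principal right ideals of index `p^{2k}` are enumerated by the Hermite normal forms
`(p^a b; 0 p^c)`, `a + c = k`, `b mod p^c`. [cite: Eichler1973, Ch. II §2 (ζ_p(s) for p ∤ DH) and §6 (16)] [cite: VignerasLNM800, Ch. II §2 Thm. 2.3] -/
theorem XiSetup.ncard_subideals_prime_pow_eq (S : XiSetup Nplus Nminus) {p : ℕ} (hp : p.Prime)
    (hpN : ¬ p ∣ Nplus * Nminus) (k : ℕ) (j : ClassSet S.O) :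
    {M : Submodule ℤ S.D | M ≤ j.rep ∧ M.toAddSubgroup.relIndex j.rep.toAddSubgroup = (p ^ k) ^ 2 ∧
        M ∈ rightIdeals S.O}.ncard = ∑ i ∈ Finset.range (k + 1), p ^ i := by
  haveI : Fact p.Prime := ⟨hp⟩
  have hdiv : ∀ x : S.D, x ≠ 0 → IsUnit x := fun x hx =>
    isUnit_of_isTotallyDefinite S.D S.isTotallyDefinite hx
  have hZ : IsZOrder S.O := S.toEichlerPackage.isEichlerOrder.isZOrder
  have hri : rightIdeals S.O = invertibleRightIdeals S.O :=
    rightIdeals_eq_invertibleRightIdeals_of_isTotallyDefinite S.isTotallyDefinite hZ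
  have hI : IsInvertibleRightIdeal S.O j.rep := by
    have hj := j.rep_mem
    rw [hri] at hj
    exact hj
  have hpNp : ¬ p ∣ Nplus := fun h => hpN (dvd_mul_of_dvd_left h Nminus)
  have hpNm : ¬ p ∣ Nminus := fun h => hpN (dvd_mul_of_dvd_right h Nplus)
  obtain ⟨O₁, hO₁, -, hloc⟩ :=
    S.toEichlerPackage.isEichlerOrder.exists_isMaximalZOrder_localAt_eq S.nplus_ne_zero hp hpNp
  obtain ⟨E⟩ := S.nonempty_algEquiv_padic hpNm
  let φ : S.D →ₐ[ℚ] Matrix (Fin 2) (Fin 2) ℚ_[p] :=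
    (E.toAlgHom.restrictScalars ℚ).comp (Algebra.TensorProduct.includeRight (R := ℚ) (A := ℚ_[p]) (B := S.D))
  obtain ⟨u, hu⟩ := hO₁.exists_conjUnit_localAt_iff hdiv φ
  have hΛ : ∀ x : S.D, x ∈ localAt p S.O ↔ ∀ a b, ‖AlgHom.conjUnit φ u x a b‖ ≤ 1 := fun x => by
    rw [show localAt p S.O = localAt p O₁ from hloc]; exact hu x
  have hcount := card_subideals_eq_card_localPrincipal (p := p) hdiv hZ hI (2 * k)
  rw [card_principal_ideals_of_split hdiv (AlgHom.conjUnit φ u) hZ hΛ k] at hcount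
  rw [← hcount, ← Nat.card_coe_set_eq]
  have hsq : (p ^ k) ^ 2 = p ^ (2 * k) := by rw [← pow_mul, mul_comm]
  exact Nat.card_congr
    { toFun := fun M => ⟨⟨M.1, by rw [← hri]; exact M.2.2.2⟩, M.2.1, M.2.2.1.trans hsq⟩
      invFun := fun M => ⟨M.1.1, M.2.1, M.2.2.trans hsq.symm, by rw [hri]; exact M.1.2⟩
      left_inv := fun M => rfl
      right_inv := fun M => rfl }

/-- **`Σ_i T(p^k)_ij = σ₁(p^k)` for a prime `p ∤ N⁺N⁻`** — the degree of the Hecke correspondence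
`t_{p^k}` (Eichler's `ζ_p(s) = (1 − p^{−2s})⁻¹(1 − p^{1−2s})⁻¹`; Gross §1, `deg t_m = σ₁(m)`). [cite: Eichler1973, Ch. II §2 and §6 (16), Thm. 2 (19)] [cite: Gross1987, §1] -/
theorem XiSetup.sum_matrix_prime_pow_eq (S : XiSetup Nplus Nminus) [Fintype (ClassSet S.O)] {p : ℕ}
    (hp : p.Prime) (hpN : ¬ p ∣ Nplus * Nminus) (k : ℕ) (j : ClassSet S.O) :
    ∑ i, matrix S.O (p ^ k) i j = sigma 1 (p ^ k) := by
  rw [S.sum_matrix_eq_ncard_subideals (pow_ne_zero k hp.ne_zero) j, S.ncard_subideals_prime_pow_eq hp hpN k j,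
    sigma_one_apply_prime_pow hp]

end Good

/-! ## §2 Ramified prime powers -/

section Ramified

/-- **At a ramified prime `p ∣ N⁻` each `I_j` has exactly one integral sub-ideal of index `p^{2a}`**
(namely `I_j 𝔓^a`; Vignéras II §1 Lemme 1.5: the ideals of the local division order are the `𝔓ⁿ`). [cite: VignerasLNM800, Ch. II §1 Lemme 1.5; Ch. III §5 exercice 5.8 (c)] [cite: Eichler1973, Ch. II §2 (ζ_p(s) for p ∣ D)] -/
theorem XiSetup.ncard_subideals_ramified_pow_eq_one (S : XiSetup Nplus Nminus) {p : ℕ} (hp : p.Prime)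
    (hpN : p ∣ Nminus) (a : ℕ) (j : ClassSet S.O) :
    {M : Submodule ℤ S.D | M ≤ j.rep ∧ M.toAddSubgroup.relIndex j.rep.toAddSubgroup = (p ^ a) ^ 2 ∧
        M ∈ rightIdeals S.O}.ncard = 1 := by
  haveI : Fact p.Prime := ⟨hp⟩
  have hZ : IsZOrder S.O := S.toEichlerPackage.isEichlerOrder.isZOrder
  have hri : rightIdeals S.O = invertibleRightIdeals S.O :=
    rightIdeals_eq_invertibleRightIdeals_of_isTotallyDefinite S.isTotallyDefinite hZ
  have hI : IsInvertibleRightIdeal S.O j.rep := by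
    have hj := j.rep_mem
    rw [hri] at hj
    exact hj
  have hdivp := S.toEichlerPackage.forall_isUnit_scalarExtension_padic hpN
  have hOp := S.toEichlerPackage.maximalAtP hpN
  have hsq : (p ^ a) ^ 2 = p ^ (2 * a) := by rw [← pow_mul, mul_comm]
  obtain ⟨M, hM, hMI, hidx⟩ := exists_subideal_pow hdivp hOp hZ hI a
  rw [Set.ncard_eq_one]
  refine ⟨M, Set.eq_singleton_iff_unique_mem.mpr ⟨⟨hMI, hidx.trans hsq.symm, by rw [hri]; exact hM⟩, ?_⟩⟩
  rintro M' ⟨hM'I, hidx', hM'⟩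
  rw [hri] at hM'
  exact (subideal_pow_unique hdivp hOp hZ hI hM hMI hidx hM' hM'I (hidx'.trans hsq)).symm

/-- **`Σ_i T(p^a)_ij = 1` for a prime `p ∣ N⁻`** (`T(p^a) = T(p)^a` is a permutation matrix). [cite: Eichler1973, Ch. II §2 and §6 Thm. 2 (20)] [cite: VignerasLNM800, Ch. III §5 exercice 5.8 (c)] -/
theorem XiSetup.sum_matrix_ramified_pow_eq_one (S : XiSetup Nplus Nminus) [Fintype (ClassSet S.O)] {p : ℕ}
    (hp : p.Prime) (hpN : p ∣ Nminus) (a : ℕ) (j : ClassSet S.O) :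
    ∑ i, matrix S.O (p ^ a) i j = 1 := by
  rw [S.sum_matrix_eq_ncard_subideals (pow_ne_zero a hp.ne_zero) j, S.ncard_subideals_ramified_pow_eq_one hp hpN a j,
    Nat.cast_one]

end Ramified

/-! ## §3 The degree formula -/

section Degree

/-- **`Σ_i T(n)_ij = σ₁(n)` for EVERY `n ≥ 1` prime to `N⁺N⁻`** (Eichler's `b(n)`; Gross: `deg t_n = σ₁(n)`). [cite: Eichler1973, Ch. II §6 Thm. 2 (18)–(19) and Cor. 1] [cite: Gross1987, §1] -/
theorem XiSetup.sum_matrix_eq_sigma (S : XiSetup Nplus Nminus) [Fintype (ClassSet S.O)] {n : ℕ}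
    (hn : n ≠ 0) (hcop : Nat.Coprime n (Nplus * Nminus)) (j : ClassSet S.O) :
    ∑ i, matrix S.O n i j = sigma 1 n := by
  induction n using Nat.recOnPrimeCoprime generalizing j with
  | zero => exact absurd rfl hn
  | prime_pow p a hp =>
    rcases Nat.eq_zero_or_pos a with rfl | ha
    · rw [pow_zero, S.sum_matrix_one_eq j, sigma_one_apply, Nat.divisors_one, sum_singleton, Nat.cast_one]
    · have hp' : ¬ p ∣ Nplus * Nminus := by
        have h := (Nat.coprime_pow_left_iff ha p (Nplus * Nminus)).mp hcop
        exact (Nat.Prime.coprime_iff_not_dvd hp).mp h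
      exact S.sum_matrix_prime_pow_eq hp hp' a j
  | coprime a b ha hb hab iha ihb =>
    rw [Nat.coprime_mul_iff_left] at hcop
    have ha0 : a ≠ 0 := by rintro rfl; exact hn (zero_mul b)
    have hb0 : b ≠ 0 := by rintro rfl; exact hn (mul_zero a)
    rw [S.sum_matrix_mul_of_coprime hab (fun k => iha ha0 hcop.1 k) j, ihb hb0 hcop.2 j,
      isMultiplicative_sigma.map_mul_of_coprime hab, Nat.cast_mul]

/-- **`Σ_i T(n)_ij = 1` for every `n ≥ 1` all of whose prime factors divide `N⁻`.** [cite: Eichler1973, Ch. II §6 Thm. 2 (20) and Cor. 1] -/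
theorem XiSetup.sum_matrix_eq_one_of_supported (S : XiSetup Nplus Nminus) [Fintype (ClassSet S.O)] {n : ℕ}
    (hn : n ≠ 0) (hram : ∀ p, p.Prime → p ∣ n → p ∣ Nminus) (j : ClassSet S.O) :
    ∑ i, matrix S.O n i j = 1 := by
  induction n using Nat.recOnPrimeCoprime generalizing j with
  | zero => exact absurd rfl hn
  | prime_pow p a hp =>
    rcases Nat.eq_zero_or_pos a with rfl | ha
    · rw [pow_zero, S.sum_matrix_one_eq j]
    · exact S.sum_matrix_ramified_pow_eq_one hp (hram p hp (dvd_pow_self p ha.ne')) a j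
  | coprime a b ha hb hab iha ihb =>
    have ha0 : a ≠ 0 := by rintro rfl; exact hn (zero_mul b)
    have hb0 : b ≠ 0 := by rintro rfl; exact hn (mul_zero a)
    rw [S.sum_matrix_mul_of_coprime hab
      (fun k => iha ha0 (fun p hp hpa => hram p hp (dvd_mul_of_dvd_left hpa b)) k) j,
      ihb hb0 (fun p hp hpb => hram p hp (dvd_mul_of_dvd_right hpb a)) j, mul_one]

/-- `n₁` prime to `N⁺N⁻` and `n₂` supported on the primes of `N⁻` are coprime. [folklore] -/
private theorem coprime_of_supported' {n₁ n₂ : ℕ} (h₁ : Nat.Coprime n₁ (Nplus * Nminus))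
    (h₂ : ∀ p, p.Prime → p ∣ n₂ → p ∣ Nminus) : Nat.Coprime n₁ n₂ := by
  refine Nat.coprime_of_dvd fun k hk hk₁ hk₂ => ?_
  have h := (h₁.coprime_dvd_left hk₁).eq_one_of_dvd (dvd_mul_of_dvd_right (h₂ k hk hk₂) Nplus)
  exact hk.one_lt.ne' h

/-- **Eichler's degree formula: `Σ_i T(n₁n₂)_ij = σ₁(n₁)` for `n₁ ≥ 1` prime to `N⁺N⁻` and `n₂ ≥ 1`
supported on the primes dividing `N⁻`** — i.e. `Σ_i T(n)_ij = Σ_{d ∣ n, (d, N⁻) = 1} d` for every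
`n ≥ 1` prime to `N⁺`: the number `b(n)` of integral right ideals of reduced norm `n · nrd I_j`
in `I_j`, the `n`-th coefficient of the zeta function of the order. [cite: Eichler1973, Ch. II §2 and §6 Thm. 2 Cor. 1] [cite: VignerasLNM800, Ch. III §5 exercice 5.8 (a)–(c)] -/
theorem XiSetup.sum_matrix_mul_eq_sigma (S : XiSetup Nplus Nminus) [Fintype (ClassSet S.O)] {n₁ n₂ : ℕ}
    (hn₁ : n₁ ≠ 0) (h₁ : Nat.Coprime n₁ (Nplus * Nminus)) (hn₂ : n₂ ≠ 0)
    (h₂ : ∀ p, p.Prime → p ∣ n₂ → p ∣ Nminus) (j : ClassSet S.O) :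
    ∑ i, matrix S.O (n₁ * n₂) i j = sigma 1 n₁ := by
  rw [S.sum_matrix_mul_of_coprime (coprime_of_supported' h₁ h₂) (fun k => S.sum_matrix_eq_sigma hn₁ h₁ k) j,
    S.sum_matrix_eq_one_of_supported hn₂ h₂ j, mul_one]

/-- **The number of integral right `O`-ideals `M ⊆ I_j` with `[I_j : M] = n²` is `σ₁(n)` for every
`n ≥ 1` prime to `N⁺N⁻`.** [cite: Eichler1973, Ch. II §6 Thm. 2 Cor. 1] [cite: VignerasLNM800, Ch. III §5 exercice 5.8 (a)] -/
theorem XiSetup.ncard_subideals_eq_sigma (S : XiSetup Nplus Nminus) {n : ℕ} (hn : n ≠ 0)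
    (hcop : Nat.Coprime n (Nplus * Nminus)) (j : ClassSet S.O) :
    {M : Submodule ℤ S.D | M ≤ j.rep ∧ M.toAddSubgroup.relIndex j.rep.toAddSubgroup = n ^ 2 ∧
        M ∈ rightIdeals S.O}.ncard = sigma 1 n := by
  letI := Fintype.ofFinite (ClassSet S.O)
  have h := S.sum_matrix_eq_ncard_subideals hn j
  rw [S.sum_matrix_eq_sigma hn hcop j] at h
  exact_mod_cast h.symm

/-- The same at `n = n₁n₂` with `n₂` supported on `N⁻`: the count is `σ₁(n₁)`. [cite: Eichler1973, Ch. II §6 Thm. 2 Cor. 1] -/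
theorem XiSetup.ncard_subideals_mul_eq_sigma (S : XiSetup Nplus Nminus) {n₁ n₂ : ℕ}
    (hn₁ : n₁ ≠ 0) (h₁ : Nat.Coprime n₁ (Nplus * Nminus)) (hn₂ : n₂ ≠ 0)
    (h₂ : ∀ p, p.Prime → p ∣ n₂ → p ∣ Nminus) (j : ClassSet S.O) :
    {M : Submodule ℤ S.D | M ≤ j.rep ∧ M.toAddSubgroup.relIndex j.rep.toAddSubgroup = (n₁ * n₂) ^ 2 ∧
        M ∈ rightIdeals S.O}.ncard = sigma 1 n₁ := by
  letI := Fintype.ofFinite (ClassSet S.O)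
  have h := S.sum_matrix_eq_ncard_subideals (mul_ne_zero hn₁ hn₂) j
  rw [S.sum_matrix_mul_eq_sigma hn₁ h₁ hn₂ h₂ j] at h
  exact_mod_cast h.symm

end Degree

/-! ## §4 Class number one -/

section ClassNumberOne

/-- With `# Cls O = 1` a Brandt matrix entry IS the column sum. [folklore] -/
private theorem XiSetup.matrix_apply_eq_sum' (S : XiSetup Nplus Nminus) [Fintype (ClassSet S.O)]
    [Subsingleton (ClassSet S.O)] (n : ℕ) (i j : ClassSet S.O) : matrix S.O n i j = ∑ k, matrix S.O n k j :=
  (Fintype.sum_subsingleton (fun k => matrix S.O n k j) i).symm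

/-- **`# Cls O = 1 ⟹ T(n)_ij = σ₁(n)` for every `n ≥ 1` prime to `N⁺N⁻`.** [cite: Eichler1973, Ch. II §6 Thm. 2 Cor. 1] -/
theorem XiSetup.matrix_apply_eq_sigma_of_subsingleton (S : XiSetup Nplus Nminus)
    [Fintype (ClassSet S.O)] [Subsingleton (ClassSet S.O)] {n : ℕ} (hn : n ≠ 0)
    (hcop : Nat.Coprime n (Nplus * Nminus)) (i j : ClassSet S.O) : matrix S.O n i j = sigma 1 n := by
  rw [S.matrix_apply_eq_sum' n i j, S.sum_matrix_eq_sigma hn hcop j]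

/-- **`# Cls O = 1 ⟹ T(n₁n₂)_ij = σ₁(n₁)`** for `n₁` prime to `N⁺N⁻` and `n₂` supported on `N⁻`. [cite: Eichler1973, Ch. II §6 Thm. 2 Cor. 1] -/
theorem XiSetup.matrix_apply_mul_eq_sigma_of_subsingleton (S : XiSetup Nplus Nminus)
    [Fintype (ClassSet S.O)] [Subsingleton (ClassSet S.O)] {n₁ n₂ : ℕ}
    (hn₁ : n₁ ≠ 0) (h₁ : Nat.Coprime n₁ (Nplus * Nminus)) (hn₂ : n₂ ≠ 0)
    (h₂ : ∀ p, p.Prime → p ∣ n₂ → p ∣ Nminus) (i j : ClassSet S.O) :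
    matrix S.O (n₁ * n₂) i j = sigma 1 n₁ := by
  rw [S.matrix_apply_eq_sum' (n₁ * n₂) i j, S.sum_matrix_mul_eq_sigma hn₁ h₁ hn₂ h₂ j]

/-- **The representation numbers of the norm form of a definite order of class number one at
every argument prime to `N⁺`: `#{x ∈ O_L(I_i) : nrd x = n₁n₂} = 2 w_i σ₁(n₁)`** (`n₁ ≥ 1` prime to
`N⁺N⁻`, `n₂ ≥ 1` supported on `N⁻`; `2 w_i T(n)_ii = #{x ∈ O_L(I_i) : nrd x = n}`,
`XiSetup.two_mul_weight_mul_matrix_diag`). For the maximal orders of the definite algebras of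
discriminant `D ∈ {2, 3, 5, 7, 13}` this is `r_D(n) = (24/(D−1))(σ₁(n) − D σ₁(n/D))` at ALL `n`. [cite: Eichler1973, Ch. II §6 (16) and Thm. 2 Cor. 1] [cite: Voight2021, Exercise 17.10] -/
theorem XiSetup.natCard_reducedNorm_eq_of_subsingleton (S : XiSetup Nplus Nminus)
    [Subsingleton (ClassSet S.O)] {n₁ n₂ : ℕ} (hn₁ : n₁ ≠ 0) (h₁ : Nat.Coprime n₁ (Nplus * Nminus))
    (hn₂ : n₂ ≠ 0) (h₂ : ∀ p, p.Prime → p ∣ n₂ → p ∣ Nminus) (i : ClassSet S.O) :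
    (Nat.card {x : S.D // x ∈ leftOrder i.rep ∧ reducedNorm ℚ S.D x = (n₁ * n₂ : ℕ)} : ℤ) =
      2 * weight S.O i * sigma 1 n₁ := by
  classical
  letI := Fintype.ofFinite (ClassSet S.O)
  rw [← S.two_mul_weight_mul_matrix_diag (mul_ne_zero hn₁ hn₂) i,
    S.matrix_apply_mul_eq_sigma_of_subsingleton hn₁ h₁ hn₂ h₂ i i]

/-- The same for `n` prime to `N⁺N⁻`: `#{x ∈ O_L(I_i) : nrd x = n} = 2 w_i σ₁(n)`. [cite: Eichler1973, Ch. II §6 (16) and Thm. 2 Cor. 1] -/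
theorem XiSetup.natCard_reducedNorm_eq_of_subsingleton' (S : XiSetup Nplus Nminus)
    [Subsingleton (ClassSet S.O)] {n : ℕ} (hn : n ≠ 0) (hcop : Nat.Coprime n (Nplus * Nminus))
    (i : ClassSet S.O) :
    (Nat.card {x : S.D // x ∈ leftOrder i.rep ∧ reducedNorm ℚ S.D x = (n : ℕ)} : ℤ) =
      2 * weight S.O i * sigma 1 n := by
  have h := S.natCard_reducedNorm_eq_of_subsingleton hn hcop one_ne_zero
    (fun p hp hp1 => absurd (Nat.le_of_dvd one_pos hp1) (not_le.mpr hp.one_lt)) i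
  rwa [mul_one] at h

end ClassNumberOne

end Brandt

end Literature.NumberTheory.Automorphic
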